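import Summits.Ventures.HodgeRepro2.T5SU11LegendreGeneratingFormal
import Mathlib.Analysis.Normed.Ring.InfiniteSum
import Mathlib.Analysis.SpecificLimits.Basic

/-!
# The generating function of the Legendre polynomials and of the spherical functions of even parameter:
`Σ_n P_n(x) rⁿ = (1 − 2xr + r²)^{−1/2}` and `Σ_n φ_{2n+2}(a_t) rⁿ = (1 − 2 cosh(2t) r + r²)^{−1/2}`

`T5SU11LegendreGeneratingFormal` proves the generating-function identity in `ℝ⟦T⟧`; this file makes it analytic on
the range where the lane has bounds: for `x ≥ 1` and `0 ≤ r < 1/ρ(x)`, `ρ(x) := x + √(x² − 1)` (so that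
`1 − 2xr + r² = (1 − rρ)(1 − r/ρ) > 0`),

* `Σ_n P_n(x) rⁿ` converges absolutely, by `1 ≤ P_n(x) ≤ ρ(x)ⁿ` (`T5SU11SphericalLegendreLaplace.legP_le_pow`)
  (`summable_legP_mul_pow`);
* the Cauchy product and the three-term recursion of the convolution squares `q_n` give
  **`(Σ_n P_n(x) rⁿ)² · (1 − 2xr + r²) = 1`** (`legGen_sq_mul`), and since the sum is `≥ 1 > 0`,
  **`Σ_n P_n(x) rⁿ = 1/√(1 − 2xr + r²)`** (`tsum_legP_mul_pow`);
* on the group, with `x = cosh 2t` and `ρ(cosh 2t) = e^{2t}` for `t ≥ 0`: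
  **`Σ_n φ_{2n+2}(a_t) rⁿ = 1/√(1 − 2 cosh(2t) r + r²)` for `0 ≤ r < e^{−2t}`** (`tsum_sph_even_hyp_mul_pow`) — the
  generating function of the spherical functions of even integer parameter; at `t = 0` it is the geometric series.

Nothing is claimed about (N).

Blind lane: Mathlib + the HodgeRepro2 prefix only; no sorry; axioms ⊆ {propext, Classical.choice,
Quot.sound}.
-/

namespace Summit.Ventures.HodgeRepro2.T5SU11LegendreGenerating

open MeasureTheory Metric Set Filter Topology Finset
open T5SU11Cartan T5SU11SphericalFunction T5SU11SphericalLegendreAll T5SU11SphericalLegendreLaplace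
  T5SU11LegendreGeneratingFormal

/-! ### The radius `ρ(x) = x + √(x² − 1)` and the quadratic -/

/-- **`ρ(x) = x + √(x² − 1)`**, the growth rate of `P_n(x)`. -/
noncomputable def rho (x : ℝ) : ℝ := x + Real.sqrt (x ^ 2 - 1)

/-- `ρ(x) ≥ 1` for `x ≥ 1`. -/
theorem one_le_rho {x : ℝ} (hx : 1 ≤ x) : 1 ≤ rho x := by
  unfold rho
  linarith [Real.sqrt_nonneg (x ^ 2 - 1)]

/-- `ρ(x) > 0` for `x ≥ 1`. -/
theorem rho_pos {x : ℝ} (hx : 1 ≤ x) : 0 < rho x := lt_of_lt_of_le one_pos (one_le_rho hx)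

/-- **`ρ · (x − √(x² − 1)) = 1`**: the inverse radius is `x − √(x² − 1)`. -/
theorem rho_mul_sub {x : ℝ} (hx : 1 ≤ x) : rho x * (x - Real.sqrt (x ^ 2 - 1)) = 1 := by
  unfold rho
  have h : Real.sqrt (x ^ 2 - 1) ^ 2 = x ^ 2 - 1 := Real.sq_sqrt (by nlinarith)
  linear_combination -h

/-- **`ρ + 1/ρ = 2x`.** -/
theorem rho_add_inv {x : ℝ} (hx : 1 ≤ x) : rho x + (rho x)⁻¹ = 2 * x := by
  have h := rho_mul_sub hx
  have hρ : rho x ≠ 0 := (rho_pos hx).ne'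
  have hinv : (rho x)⁻¹ = x - Real.sqrt (x ^ 2 - 1) := inv_eq_of_mul_eq_one_right h
  rw [hinv, rho]
  ring

/-- **`1 − 2xr + r² = (1 − rρ)(1 − r/ρ)`.** -/
theorem quad_eq_mul {x : ℝ} (hx : 1 ≤ x) (r : ℝ) :
    1 - 2 * x * r + r ^ 2 = (1 - r * rho x) * (1 - r * (rho x)⁻¹) := by
  have h := rho_add_inv hx
  have hρ : rho x ≠ 0 := (rho_pos hx).ne'
  have : rho x * (rho x)⁻¹ = 1 := mul_inv_cancel₀ hρ
  linear_combination r * h - r ^ 2 * this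

/-- **`1 − 2xr + r² > 0`** for `x ≥ 1`, `0 ≤ r`, `rρ(x) < 1`. -/
theorem quad_pos {x r : ℝ} (hx : 1 ≤ x) (hr0 : 0 ≤ r) (hr : r * rho x < 1) : 0 < 1 - 2 * x * r + r ^ 2 := by
  rw [quad_eq_mul hx]
  have hρ := rho_pos hx
  have h1 : r * (rho x)⁻¹ ≤ r * rho x := by
    apply mul_le_mul_of_nonneg_left _ hr0
    rw [inv_le_comm₀ hρ (by linarith [one_le_rho hx])]
    calc (rho x)⁻¹ ≤ 1 := inv_le_one_of_one_le₀ (one_le_rho hx)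
      _ ≤ rho x := one_le_rho hx
  apply mul_pos <;> linarith

/-! ### Absolute convergence -/

/-- `P_n(x) ≥ 1` for `x ≥ 1` (`T5SU11SphericalLegendreAll.one_le_legP`, freed of the measurable structure on the
circle it was proved with). -/
theorem one_le_legP' (n : ℕ) {x : ℝ} (hx : 1 ≤ x) : 1 ≤ legP n x := by
  letI : MeasurableSpace Circle := borel Circle
  haveI : BorelSpace Circle := ⟨rfl⟩
  exact one_le_legP n hx

/-- `P_n(x) ≤ ρ(x)ⁿ` for `x ≥ 1` (`T5SU11SphericalLegendreLaplace.legP_le_pow`, likewise). -/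
theorem legP_le_rho_pow (n : ℕ) {x : ℝ} (hx : 1 ≤ x) : legP n x ≤ rho x ^ n := by
  letI : MeasurableSpace Circle := borel Circle
  haveI : BorelSpace Circle := ⟨rfl⟩
  exact legP_le_pow n hx

/-- `0 ≤ P_n(x) rⁿ`. -/
theorem legP_mul_pow_nonneg {x r : ℝ} (hx : 1 ≤ x) (hr0 : 0 ≤ r) (n : ℕ) : 0 ≤ legP n x * r ^ n :=
  mul_nonneg (by linarith [one_le_legP' n hx]) (pow_nonneg hr0 n)

/-- **`Σ_n P_n(x) rⁿ` converges** for `x ≥ 1`, `0 ≤ r`, `rρ(x) < 1`, by `P_n(x) rⁿ ≤ (rρ)ⁿ`. -/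
theorem summable_legP_mul_pow {x r : ℝ} (hx : 1 ≤ x) (hr0 : 0 ≤ r) (hr : r * rho x < 1) :
    Summable fun n => legP n x * r ^ n := by
  refine Summable.of_nonneg_of_le (legP_mul_pow_nonneg hx hr0) (fun n => ?_)
    (summable_geometric_of_lt_one (mul_nonneg hr0 (rho_pos hx).le) hr)
  rw [mul_pow, mul_comm]
  exact mul_le_mul_of_nonneg_left (legP_le_rho_pow n hx) (pow_nonneg hr0 n)

/-- The same in norm. -/
theorem summable_norm_legP_mul_pow {x r : ℝ} (hx : 1 ≤ x) (hr0 : 0 ≤ r) (hr : r * rho x < 1) :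
    Summable fun n => ‖legP n x * r ^ n‖ :=
  summable_norm_iff.mpr (summable_legP_mul_pow hx hr0 hr)

/-! ### The Cauchy product -/

/-- **The generating function `S_x(r) = Σ_n P_n(x) rⁿ`.** -/
noncomputable def legGen (x r : ℝ) : ℝ := ∑' n, legP n x * r ^ n

/-- The Cauchy product: `S_x(r)² = Σ_n q_n rⁿ`, `q_n = Σ_{i+j=n} P_i(x) P_j(x)`. -/
theorem legGen_mul_legGen {x r : ℝ} (hx : 1 ≤ x) (hr0 : 0 ≤ r) (hr : r * rho x < 1) :
    legGen x r * legGen x r = ∑' n, PowerSeries.coeff n (legSeries x * legSeries x) * r ^ n := by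
  unfold legGen
  rw [tsum_mul_tsum_eq_tsum_sum_antidiagonal_of_summable_norm (summable_norm_legP_mul_pow hx hr0 hr)
    (summable_norm_legP_mul_pow hx hr0 hr)]
  refine tsum_congr fun n => ?_
  rw [coeff_legSeries_sq, Finset.sum_mul]
  refine Finset.sum_congr rfl fun ij hij => ?_
  rw [← Finset.HasAntidiagonal.mem_antidiagonal.mp hij, pow_add]
  ring

/-- `Σ_n q_n rⁿ` converges. -/
theorem summable_coeff_sq_mul_pow {x r : ℝ} (hx : 1 ≤ x) (hr0 : 0 ≤ r) (hr : r * rho x < 1) :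
    Summable fun n => PowerSeries.coeff n (legSeries x * legSeries x) * r ^ n := by
  have h := (summable_norm_sum_mul_antidiagonal_of_summable_norm (summable_norm_legP_mul_pow hx hr0 hr)
    (summable_norm_legP_mul_pow hx hr0 hr)).of_norm
  refine h.congr fun n => ?_
  rw [coeff_legSeries_sq, Finset.sum_mul]
  refine Finset.sum_congr rfl fun ij hij => ?_
  rw [← Finset.HasAntidiagonal.mem_antidiagonal.mp hij, pow_add]
  ring

/-! ### The generating function identity -/

/-- **`S_x(r)² · (1 − 2xr + r²) = 1`.** -/
theorem legGen_sq_mul {x r : ℝ} (hx : 1 ≤ x) (hr0 : 0 ≤ r) (hr : r * rho x < 1) :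
    legGen x r ^ 2 * (1 - 2 * x * r + r ^ 2) = 1 := by
  rw [sq, legGen_mul_legGen hx hr0 hr]
  obtain ⟨u, hu_def⟩ : ∃ u : ℕ → ℝ, (fun n => PowerSeries.coeff n (legSeries x * legSeries x) * r ^ n) = u :=
    ⟨_, rfl⟩
  have hu_app : ∀ n, u n = PowerSeries.coeff n (legSeries x * legSeries x) * r ^ n := fun n => by
    rw [← hu_def]
  rw [show (∑' n, PowerSeries.coeff n (legSeries x * legSeries x) * r ^ n) = ∑' n, u n by rw [← hu_def]]
  have hu : Summable u := hu_def ▸ summable_coeff_sq_mul_pow hx hr0 hr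
  have hu1 : Summable fun n => u (n + 1) := (summable_nat_add_iff 1).mpr hu
  have hu2 : Summable fun n => u (n + 2) := (summable_nat_add_iff 2).mpr hu
  have e0 : ∑' n, u n = u 0 + ∑' n, u (n + 1) := hu.tsum_eq_zero_add
  have e1 : ∑' n, u (n + 1) = u 1 + ∑' n, u (n + 2) := hu1.tsum_eq_zero_add
  have hz : ∀ n, u (n + 2) - 2 * x * r * u (n + 1) + r ^ 2 * u n = 0 := fun n => by
    have h := coeff_legSeries_sq_recursion x n
    rw [hu_app, hu_app, hu_app]
    calc PowerSeries.coeff (n + 2) (legSeries x * legSeries x) * r ^ (n + 2)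
          - 2 * x * r * (PowerSeries.coeff (n + 1) (legSeries x * legSeries x) * r ^ (n + 1))
          + r ^ 2 * (PowerSeries.coeff n (legSeries x * legSeries x) * r ^ n)
        = r ^ (n + 2) * (PowerSeries.coeff (n + 2) (legSeries x * legSeries x)
            - 2 * x * PowerSeries.coeff (n + 1) (legSeries x * legSeries x)
            + PowerSeries.coeff n (legSeries x * legSeries x)) := by ring
      _ = 0 := by rw [h, mul_zero]
  have hsum : ∑' n, (u (n + 2) - 2 * x * r * u (n + 1) + r ^ 2 * u n) = 0 := by
    simp only [hz, tsum_zero]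
  rw [Summable.tsum_add (hu2.sub (hu1.mul_left _)) (hu.mul_left _), Summable.tsum_sub hu2 (hu1.mul_left _),
    tsum_mul_left, tsum_mul_left] at hsum
  have hu0 : u 0 = 1 := by rw [hu_app, coeff_legSeries_sq_zero, pow_zero, mul_one]
  have hu1' : u 1 = 2 * x * r := by rw [hu_app, coeff_legSeries_sq_one, pow_one]
  linear_combination (1 - 2 * x * r) * e0 + e1 + hsum + (1 - 2 * x * r) * hu0 + hu1'

/-- **`S_x(r) ≥ 1`** (the `n = 0` term is `1` and every term is `≥ 0`). -/
theorem one_le_legGen {x r : ℝ} (hx : 1 ≤ x) (hr0 : 0 ≤ r) (hr : r * rho x < 1) : 1 ≤ legGen x r := by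
  have h := (summable_legP_mul_pow hx hr0 hr).le_tsum 0 fun j _ => legP_mul_pow_nonneg hx hr0 j
  simpa [legGen] using h

/-- **`Σ_n P_n(x) rⁿ = 1/√(1 − 2xr + r²)`** for `x ≥ 1`, `0 ≤ r < 1/ρ(x)`. -/
theorem legGen_eq {x r : ℝ} (hx : 1 ≤ x) (hr0 : 0 ≤ r) (hr : r * rho x < 1) :
    legGen x r = 1 / Real.sqrt (1 - 2 * x * r + r ^ 2) := by
  have hq := quad_pos hx hr0 hr
  have hS : 0 < legGen x r := lt_of_lt_of_le one_pos (one_le_legGen hx hr0 hr)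
  have h := legGen_sq_mul hx hr0 hr
  rw [eq_div_iff (Real.sqrt_pos.mpr hq).ne']
  have : (legGen x r * Real.sqrt (1 - 2 * x * r + r ^ 2)) ^ 2 = 1 := by
    rw [mul_pow, Real.sq_sqrt hq.le, h]
  have hpos : 0 < legGen x r * Real.sqrt (1 - 2 * x * r + r ^ 2) := mul_pos hS (Real.sqrt_pos.mpr hq)
  nlinarith [this, hpos]

/-- The same, spelled out. -/
theorem tsum_legP_mul_pow {x r : ℝ} (hx : 1 ≤ x) (hr0 : 0 ≤ r) (hr : r * rho x < 1) :
    ∑' n, legP n x * r ^ n = 1 / Real.sqrt (1 - 2 * x * r + r ^ 2) :=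
  legGen_eq hx hr0 hr

/-- The cross-check `x = 1`: `Σ_n rⁿ = 1/(1 − r)`. -/
theorem tsum_legP_one_mul_pow {r : ℝ} (hr0 : 0 ≤ r) (hr : r < 1) :
    ∑' n, legP n 1 * r ^ n = 1 / (1 - r) := by
  simp only [legP_one, one_mul]
  rw [tsum_geometric_of_lt_one hr0 hr, one_div]

/-! ### On the group: the generating function of `φ_{2n+2}(a_t)` -/

/-- **`ρ(cosh 2t) = e^{2t}`** for `t ≥ 0`. -/
theorem rho_cosh {t : ℝ} (ht : 0 ≤ t) : rho (Real.cosh (2 * t)) = Real.exp (2 * t) := by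
  unfold rho
  have h : Real.sqrt (Real.cosh (2 * t) ^ 2 - 1) = Real.sinh (2 * t) := by
    rw [Real.cosh_sq, add_sub_cancel_right, Real.sqrt_sq (Real.sinh_nonneg_iff.mpr (by linarith))]
  rw [h, Real.cosh_add_sinh]

section measure

variable [MeasurableSpace Circle] [BorelSpace Circle]

/-- **`Σ_n φ_{2n+2}(a_t) rⁿ = 1/√(1 − 2 cosh(2t) r + r²)`** for `t ≥ 0`, `0 ≤ r`, `r e^{2t} < 1`. -/
theorem tsum_sph_even_hyp_mul_pow {t r : ℝ} (ht : 0 ≤ t) (hr0 : 0 ≤ r) (hr : r * Real.exp (2 * t) < 1) :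
    ∑' n : ℕ, sph (2 * (n : ℝ) + 2) (hyp t) * r ^ n
      = 1 / Real.sqrt (1 - 2 * Real.cosh (2 * t) * r + r ^ 2) := by
  simp only [sph_even_hyp]
  exact tsum_legP_mul_pow (Real.one_le_cosh (2 * t)) hr0 (by rwa [rho_cosh ht])

/-- The same series converges. -/
theorem summable_sph_even_hyp_mul_pow {t r : ℝ} (ht : 0 ≤ t) (hr0 : 0 ≤ r) (hr : r * Real.exp (2 * t) < 1) :
    Summable fun n : ℕ => sph (2 * (n : ℝ) + 2) (hyp t) * r ^ n := by
  simp only [sph_even_hyp]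
  exact summable_legP_mul_pow (Real.one_le_cosh (2 * t)) hr0 (by rwa [rho_cosh ht])

end measure

end Summit.Ventures.HodgeRepro2.T5SU11LegendreGenerating
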